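import Mathlib
import Summits.ResolutionOfSingularities.ResolutionOfSingularities.Theorems.RadicialJungCleanModelsCleanProp44CurveVeryNear
import Literature.AlgebraicGeometry.Resolution.MarkedIdealsEtale
import Literature.AlgebraicGeometry.Resolution.StalkIdealLemmas
import HarnessLib

/-!
# Route `RadicialJung`, crux `CleanModels` (stmt-ResolutionOfSingularities-15917), line `Sketch` rev 35, stub 6 `stub_cleanProp44` (X44c):
# «no very near point» is LOCAL ON THE BASE — the very-near hypotheses of the fourth/fifth cuts stated on `X` itself

Seat decomp-res-hand-2 g15 (structural hand), companion of ✓ `…CleanProp44TauOneVeryNear.lean` / ✓ `…CleanProp44CurveVeryNear.lean`.  There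
the «no very near point» hypotheses are phrased with the blowing ups of the OPEN `V` of the slice (the currency the slices live in).  Here:

* `forall_near_two_le_preimage_of_forall_near_two_le` — **the condition descends from `X` to its opens**: if every blowing up
  `π : X₁ → X` along a closed `Y ⊆ X` has `τ ≥ 2` at its closed threefold near points over `Y`, then so does every blowing up of the open
  subscheme `V` along `Y ∩ V` (blow-ups restrict ✓ `IsBlowup.restrict`, are unique ✓ `IsBlowup.unique`, controlled transforms commute with the
  open immersion ✓ `comap_controlledTransform_of_flat`, and `τ`, orders, embedding dimension and closedness travel along local isomorphisms
  ✓ `stalkTau_eq_of_isIso_stalkMap`, ✓ `idealOrder_comap_of_isOpenImmersion`, ✓ `CampaignW46.spanFinrank_eq_of_isIso_stalkMap`).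
* `forall_near_two_le_point_of_forall_near_two_le` — the same for a closed point `x ∈ V`.
* `cleanProp44_of_tauOneResidualVN3` — **SIXTH CUT: X44c ⟸ (R1) ∧ (R2ᵛⁿ′) ∧ (R3ᵛⁿ′)** with the very-near binders now ON `X`: (R2ᵛⁿ′) asks the
  clean `τ = 1` isolated-point slice only at points `x` such that SOME blowing up of `X` at `x` has a closed threefold near point with `τ ≤ 1`
  (a very near point); (R3ᵛⁿ′) asks the clean curve slice only for curves `Y` that need an insertion or such that some blowing up of `X` along `Y`
  has a closed threefold near point over `Y` with `τ ≤ 1`.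

Honest framing: OURS; (R1), (R2ᵛⁿ′), (R3ᵛⁿ′) are NOT proved here; nothing here proves X44c, any case of `CleanModels`, or resolution of
singularities in characteristic `p`. [cite: GortzWedhorn2020, Prop. 13.91] [cite: CossartPiltant2008, Prop. 4.2 (b), Prop. 4.4]
[cite: BierstoneGrigorievMilmanWlodarczyk2011, §3.2 with Thm. 8.0.5]
-/

noncomputable section

set_option linter.dupNamespace false -- mandated namespace of this single-conjunct summit

open CategoryTheory CategoryTheory.Limits AlgebraicGeometry TopologicalSpace IsLocalRing
open Literature.AlgebraicGeometry.Resolution Literature.AlgebraicGeometry.Motives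
open Scheme.IdealSheafData
open Summit.ResolutionOfSingularities.ResolutionOfSingularities.Theorems.CP2008Prop44

namespace Summit.ResolutionOfSingularities.ResolutionOfSingularities.Theorems.RadicialJung.CleanModels

/-! ## §1 «no very near point» descends to opens -/

set_option maxHeartbeats 800000 in
-- transport along the open immersion of blow-ups
/-- **«`τ ≥ 2` at the closed threefold near points over `Y`» descends from `X` to its opens.**  `X` integral Noetherian of dimension `≤ 3`,
`J`, `μ`, `Y ⊆ X` closed, `V ⊆ X` open.  If for every blowing up `π : X₁ → X` along `Y` every closed point `x'` over `Y` with
`ord_{x'} J₁ = μ` (`J₁` the controlled transform) and embedding dimension `3` has `τ_{x'}(J₁, μ) ≥ 2`, then the same holds for every blowing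
up of the open subscheme `V` along `Y ∩ V` and `J|_V`. [cite: GortzWedhorn2020, Prop. 13.91] [cite: BierstoneGrigorievMilmanWlodarczyk2011, §3.2] -/
theorem forall_near_two_le_preimage_of_forall_near_two_le {X : Scheme.{0}} [IsIntegral X] [IsNoetherian X]
    (hX3 : topologicalKrullDim X ≤ 3) (J : X.IdealSheafData) (μ : ℕ) (V : X.Opens) (Y : Closeds X)
    (hvn : ∀ (X₁ : Scheme.{0}) (π : X₁ ⟶ X), IsBlowup π (vanishingIdeal Y) →
      ∀ x' : X₁, IsClosed ({x'} : Set X₁) → π x' ∈ (Y : Set X) →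
        idealOrder (controlledTransform π (vanishingIdeal Y) J μ) x' = μ →
        (maximalIdeal (X₁.presheaf.stalk x')).spanFinrank = 3 →
        ∀ hr : IsRegularLocalRing (X₁.presheaf.stalk x'), 2 ≤ @stalkTau X₁ (controlledTransform π (vanishingIdeal Y) J μ) x' hr μ) :
    ∀ (V₁ : Scheme.{0}) (π₁ : V₁ ⟶ (V : Scheme.{0})), IsBlowup π₁ (vanishingIdeal (Y.preimage V.ι.continuous)) →
      ∀ x' : V₁, IsClosed ({x'} : Set V₁) → π₁ x' ∈ ((Y.preimage V.ι.continuous : Closeds (V : Scheme.{0})) : Set (V : Scheme.{0})) →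
        idealOrder (controlledTransform π₁ (vanishingIdeal (Y.preimage V.ι.continuous)) (J.comap V.ι) μ) x' = μ →
        (maximalIdeal (V₁.presheaf.stalk x')).spanFinrank = 3 →
        ∀ hr : IsRegularLocalRing (V₁.presheaf.stalk x'),
          2 ≤ @stalkTau V₁ (controlledTransform π₁ (vanishingIdeal (Y.preimage V.ι.continuous)) (J.comap V.ι) μ) x' hr μ := by
  intro V₁ π₁ hπ₁ v' hv'cl hv'Y hord' hd' hr'
  set C : X.IdealSheafData := vanishingIdeal Y with hCdef
  have hCV : C.comap V.ι = vanishingIdeal (Y.preimage V.ι.continuous) := comap_vanishingIdeal_of_isOpenImmersion V.ι Y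
  rw [← hCV] at hπ₁ hord' ⊢
  -- the blowing up of `X` along `Y`, restricted over `V`, is isomorphic to `π₁`
  obtain ⟨X₁, π, hπ⟩ := exists_isBlowup X C
  haveI : IsLocallyNoetherian X₁ := hπ.isLocallyNoetherian
  haveI : IsLocallyNoetherian V₁ := hπ₁.isLocallyNoetherian
  have hres : IsBlowup (π ∣_ V) (C.comap V.ι) := hπ.restrict V
  obtain ⟨e, he, -⟩ := hπ₁.unique hres
  set s : V₁ ⟶ X₁ := e.hom ≫ (π ⁻¹ᵁ V).ι with hsdef
  have hsq : s ≫ π = π₁ ≫ V.ι := by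
    rw [hsdef, Category.assoc, ← morphismRestrict_ι, ← Category.assoc, he]
  -- the controlled transforms match along the open immersion `s`
  have hCT : (controlledTransform π C J μ).comap s = controlledTransform π₁ (C.comap V.ι) (J.comap V.ι) μ :=
    comap_controlledTransform_of_flat V.ι hsq C J μ
  -- the point `s v'` of `X₁`: over `Y`, isomorphic local ring
  haveI hiso : IsIso (s.stalkMap v') := (IsOpenImmersion.iff_isIso_stalkMap.mp inferInstance).2 v'
  haveI hrx' : IsRegularLocalRing (X₁.presheaf.stalk (s v')) :=
    IsRegularLocalRing.of_ringEquiv (asIso (s.stalkMap v')).commRingCatIsoToRingEquiv.symm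
  have hπx' : π (s v') ∈ (Y : Set X) := by
    rw [← Scheme.Hom.comp_apply, hsq, Scheme.Hom.comp_apply]
    have h := hv'Y
    rw [Closeds.coe_preimage, Set.mem_preimage] at h
    exact h
  have hdx' : (maximalIdeal (X₁.presheaf.stalk (s v'))).spanFinrank = 3 := by
    rw [← CampaignW46.spanFinrank_eq_of_isIso_stalkMap s v']
    exact hd'
  have hX3₁ : topologicalKrullDim X₁ ≤ 3 := hπ.topologicalKrullDim_le hX3
  have hcoh3₁ : ∀ z : X₁, Order.coheight z ≤ 3 := (topologicalKrullDim_le_iff_forall_coheight_le X₁ 3).mp hX3₁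
  have hcohx' : Order.coheight (s v') = 3 := by
    have h := CampaignW46.coheight_eq_spanFinrank (s v')
    rw [hdx'] at h
    exact_mod_cast h
  have hx'cl : IsClosed ({s v'} : Set X₁) := isClosed_singleton_of_coheight_eq_three hcoh3₁ hcohx'
  have hordx' : idealOrder (controlledTransform π C J μ) (s v') = μ := by
    rw [← idealOrder_comap_of_isOpenImmersion s, hCT]
    exact hord'
  -- `τ` travels along `s`
  have hτx' := hvn X₁ π hπ (s v') hx'cl hπx' hordx' hdx' hrx'
  have hτeq : @stalkTau V₁ (controlledTransform π₁ (C.comap V.ι) (J.comap V.ι) μ) v' hr' μ =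
      stalkTau (controlledTransform π C J μ) (s v') μ := by
    rw [← hCT]
    exact stalkTau_eq_of_isIso_stalkMap s v' _ _ (stalkIdeal_comap_eq_map_stalkMap s _ v') μ
  rw [hτeq]
  exact hτx'

/-- **The same for a closed point `x ∈ V`** (the `Closeds` bookkeeping `Y = {x}`, `Y ∩ V = {x}`). [cite: GortzWedhorn2020, Prop. 13.91] -/
theorem forall_near_two_le_point_of_forall_near_two_le {X : Scheme.{0}} [IsIntegral X] [IsNoetherian X]
    (hX3 : topologicalKrullDim X ≤ 3) (J : X.IdealSheafData) (μ : ℕ) (V : X.Opens) (x : X) (hxV : x ∈ V) (hcl : IsClosed ({x} : Set X))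
    (hvn : ∀ (X₁ : Scheme.{0}) (π : X₁ ⟶ X), IsBlowup π (vanishingIdeal ⟨{x}, hcl⟩) →
      ∀ x' : X₁, IsClosed ({x'} : Set X₁) → π x' = x →
        idealOrder (controlledTransform π (vanishingIdeal ⟨{x}, hcl⟩) J μ) x' = μ →
        (maximalIdeal (X₁.presheaf.stalk x')).spanFinrank = 3 →
        ∀ hr : IsRegularLocalRing (X₁.presheaf.stalk x'), 2 ≤ @stalkTau X₁ (controlledTransform π (vanishingIdeal ⟨{x}, hcl⟩) J μ) x' hr μ) :
    ∀ (hclV : IsClosed ({(⟨x, hxV⟩ : (V : Scheme.{0}))} : Set (V : Scheme.{0})))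
      (V₁ : Scheme.{0}) (π₁ : V₁ ⟶ (V : Scheme.{0})), IsBlowup π₁ (vanishingIdeal ⟨{(⟨x, hxV⟩ : (V : Scheme.{0}))}, hclV⟩) →
      ∀ x' : V₁, IsClosed ({x'} : Set V₁) → π₁ x' = ⟨x, hxV⟩ →
        idealOrder (controlledTransform π₁ (vanishingIdeal ⟨{(⟨x, hxV⟩ : (V : Scheme.{0}))}, hclV⟩) (J.comap V.ι) μ) x' = μ →
        (maximalIdeal (V₁.presheaf.stalk x')).spanFinrank = 3 →
        ∀ hr : IsRegularLocalRing (V₁.presheaf.stalk x'),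
          2 ≤ @stalkTau V₁ (controlledTransform π₁ (vanishingIdeal ⟨{(⟨x, hxV⟩ : (V : Scheme.{0}))}, hclV⟩) (J.comap V.ι) μ) x' hr μ := by
  intro hclV V₁ π₁ hπ₁ v' hv'cl hv'x hord' hd' hr'
  have hpre : (⟨{x}, hcl⟩ : Closeds X).preimage V.ι.continuous = ⟨{(⟨x, hxV⟩ : (V : Scheme.{0}))}, hclV⟩ := by
    apply Closeds.ext
    ext v
    simp only [Closeds.coe_preimage, Set.mem_preimage, Closeds.coe_mk, Set.mem_singleton_iff, Scheme.Opens.ι_apply]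
    constructor
    · intro h; exact Subtype.ext h
    · intro h; rw [h]
  have key := forall_near_two_le_preimage_of_forall_near_two_le hX3 J μ V ⟨{x}, hcl⟩
    (fun X₁ π hπ x' hx'cl hx'Y => hvn X₁ π hπ x' hx'cl hx'Y) V₁ π₁ (by rw [hpre]; exact hπ₁) v' hv'cl
    (by rw [hpre]; exact hv'x) (by rw [hpre]; exact hord') hd' hr'
  rw [hpre] at key
  exact key

/-! ## §2 SIXTH CUT: the very-near binders on `X` -/

set_option maxHeartbeats 1600000 in
-- long binder lists
/-- **THE CLEAN ASSEMBLY, SIXTH CUT: X44c (`stub_cleanProp44`, verbatim) ⟸ (R1) ∧ (R2ᵛⁿ′) ∧ (R3ᵛⁿ′)**, with the very-near binders phrased with the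
blowing ups of the STAGE `X` itself: (R2ᵛⁿ′) = `htauOne` of ✓ `cleanProp44_of_tauOneResidual` plus «NOT every blowing up of `X` at `x` has
`τ ≥ 2` at its closed threefold near points»; (R3ᵛⁿ′) = `hcurveTauOne` plus «NOT (clean-permissible at every point of `Y` AND every blowing up of
`X` along `Y` has `τ ≥ 2` at its closed threefold near points over `Y`)».  Over ✓ `cleanProp44_of_tauOneResidualVN2` by §1.
[cite: CossartPiltant2008, Prop. 4.4, Lemma 4.5] [cite: Piltant2013, Prop. 5.1 (proof, Step 2)] -/
theorem cleanProp44_of_tauOneResidualVN3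
    (hphaseTwo : ∀ (p : ℕ), p.Prime → ∀ {X : Scheme.{0}} [IsIntegral X] [IsNoetherian X], CharP X.functionField p →
      ∀ (hX : Scheme.IsRegular X), Scheme.IsQuasiExcellent X → topologicalKrullDim X ≤ 3 →
      ∀ (G : X.functionField), (∀ x : X, CleanRegAt p (algebraMap (X.presheaf.stalk x) X.functionField) G) →
      ∀ (J : X.IdealSheafData) {μ : ℕ}, 1 ≤ μ → (∀ z, idealOrder J z ≤ μ) → (∀ z ∈ J.support, 1 < Order.coheight z) →
      (∀ x : X, ¬ ∃ C ∈ {C : Closeds X | ∃ ζ ∈ maxPoints {z : X | (μ : ℕ∞) ≤ idealOrder J z},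
          ¬ IsClosed ({ζ} : Set X) ∧ C = ⟨closure {ζ}, isClosed_closure⟩},
        x ∈ (vanishingIdeal C).subschemeι '' (Scheme.regularLocus (vanishingIdeal C).subscheme)ᶜ ∨
        (x ∈ (C : Set X) ∧ ∃ C' ∈ {C : Closeds X | ∃ ζ ∈ maxPoints {z : X | (μ : ℕ∞) ≤ idealOrder J z},
            ¬ IsClosed ({ζ} : Set X) ∧ C = ⟨closure {ζ}, isClosed_closure⟩}, C' ≠ C ∧ x ∈ (C' : Set X) ∧
          stalkIdeal (vanishingIdeal C) x ⊔ stalkIdeal (vanishingIdeal C') x ≠ maximalIdeal (X.presheaf.stalk x))) →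
      ∃ (X₁ : Scheme.{0}) (Φ : X₁ ⟶ X) (_ : IsIntegral X₁) (_ : IsDominant Φ) (J₁ : X₁.IdealSheafData)
        (_ : IsCleanPermissibleSeq p Φ J μ J₁ G),
        (∀ ζ : X₁, (μ : ℕ∞) ≤ idealOrder J₁ ζ → Order.coheight ζ = 2 → ¬ IsClosed ({ζ} : Set X₁) →
            Scheme.IsRegular (vanishingIdeal (⟨closure {ζ}, isClosed_closure⟩ : Closeds X₁)).subscheme) ∧
        (∀ ζ₁ ζ₂ : X₁, (μ : ℕ∞) ≤ idealOrder J₁ ζ₁ → Order.coheight ζ₁ = 2 → ¬ IsClosed ({ζ₁} : Set X₁) →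
            (μ : ℕ∞) ≤ idealOrder J₁ ζ₂ → Order.coheight ζ₂ = 2 → ¬ IsClosed ({ζ₂} : Set X₁) → ζ₁ ≠ ζ₂ →
            Disjoint (closure ({ζ₁} : Set X₁)) (closure {ζ₂})))
    (htauOneVN : ∀ (p : ℕ), p.Prime → ∀ {X : Scheme.{0}} [IsIntegral X] [IsNoetherian X], CharP X.functionField p →
      ∀ (hX : Scheme.IsRegular X), Scheme.IsQuasiExcellent X → topologicalKrullDim X ≤ 3 →
      ∀ (G : X.functionField), (∀ x : X, CleanRegAt p (algebraMap (X.presheaf.stalk x) X.functionField) G) →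
      ∀ (J : X.IdealSheafData) {m : ℕ}, 1 ≤ m → (∀ z, idealOrder J z ≤ m) → (∀ z ∈ J.support, 1 < Order.coheight z) →
      ∀ (V : X.Opens) (x : X), x ∈ V → ∀ (hcl : IsClosed ({x} : Set X)),
      (∀ z : X, (m : ℕ∞) ≤ idealOrder J z → z = x ∨ z ∉ (V : Set X)) → idealOrder J x = m →
      (maximalIdeal (X.presheaf.stalk x)).spanFinrank = 3 → (haveI := hX x; stalkTau J x m = 1) → IsGRing (X.presheaf.stalk x) →
      -- (VN′) SOME blowing up of `X` at `x` has a closed threefold near point with `τ ≤ 1`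
      (¬ ∀ (X₁ : Scheme.{0}) (π : X₁ ⟶ X), IsBlowup π (vanishingIdeal ⟨{x}, hcl⟩) →
        ∀ x' : X₁, IsClosed ({x'} : Set X₁) → π x' = x →
          idealOrder (controlledTransform π (vanishingIdeal ⟨{x}, hcl⟩) J m) x' = m →
          (maximalIdeal (X₁.presheaf.stalk x')).spanFinrank = 3 →
          ∀ hr : IsRegularLocalRing (X₁.presheaf.stalk x'), 2 ≤ @stalkTau X₁ (controlledTransform π (vanishingIdeal ⟨{x}, hcl⟩) J m) x' hr m) →
      ∀ [IsIntegral ((V : X.Opens) : Scheme.{0})] [IsDominant V.ι],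
      ∃ (V' : Scheme.{0}) (π : V' ⟶ V) (_ : IsIntegral V') (_ : IsDominant π) (K' : V'.IdealSheafData),
        IsCleanPermissibleSeq p π (J.comap V.ι) m K' (RatFn.functionFieldMap V.ι G) ∧ ∀ y, idealOrder K' y < m)
    (hcurveTauOneVN : ∀ (p : ℕ), p.Prime → ∀ {X : Scheme.{0}} [IsIntegral X] [IsNoetherian X], CharP X.functionField p →
      ∀ (hX : Scheme.IsRegular X), Scheme.IsQuasiExcellent X → topologicalKrullDim X ≤ 3 →
      ∀ (G : X.functionField), (∀ x : X, CleanRegAt p (algebraMap (X.presheaf.stalk x) X.functionField) G) →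
      ∀ (J : X.IdealSheafData) {m : ℕ}, 1 ≤ m → (∀ z, idealOrder J z ≤ m) → (∀ z ∈ J.support, 1 < Order.coheight z) →
      ∀ (V : X.Opens) (Y : Closeds X), Scheme.IsRegular (vanishingIdeal Y).subscheme → IsIrreducible (Y : Set X) →
      (Y : Set X) ⊆ (V : Set X) → (∀ z : X, (m : ℕ∞) ≤ idealOrder J z → z ∈ (Y : Set X) ∨ z ∉ (V : Set X)) →
      (∀ y ∈ (Y : Set X), idealOrder J y = m) →
      (∀ y ∈ (Y : Set X), haveI := hX y; ∃ c : Fin 2 → X.presheaf.stalk y, IsRsopPart c ∧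
        Ideal.span (Set.range c) = stalkIdeal (vanishingIdeal Y) y) →
      (¬ ∀ y ∈ (Y : Set X), IsClosed ({y} : Set X) → haveI := hX y; 2 ≤ stalkTau J y m) →
      -- (VN′) NOT (clean-permissible at every point of `Y` AND no very near point over `Y` for the blowing ups of `X` along `Y`)
      (¬ ((∀ y ∈ (Y : Set X), CleanPermissibleAt p (algebraMap (X.presheaf.stalk y) X.functionField) G (stalkIdeal (vanishingIdeal Y) y)) ∧
          (∀ (X₁ : Scheme.{0}) (π : X₁ ⟶ X), IsBlowup π (vanishingIdeal Y) →
            ∀ x' : X₁, IsClosed ({x'} : Set X₁) → π x' ∈ (Y : Set X) →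
              idealOrder (controlledTransform π (vanishingIdeal Y) J m) x' = m →
              (maximalIdeal (X₁.presheaf.stalk x')).spanFinrank = 3 →
              ∀ hr : IsRegularLocalRing (X₁.presheaf.stalk x'), 2 ≤ @stalkTau X₁ (controlledTransform π (vanishingIdeal Y) J m) x' hr m))) →
      ∀ [IsIntegral ((V : X.Opens) : Scheme.{0})] [IsDominant V.ι],
      ∃ (V' : Scheme.{0}) (π : V' ⟶ V) (_ : IsIntegral V') (_ : IsDominant π) (K' : V'.IdealSheafData),
        IsCleanPermissibleSeq p π (J.comap V.ι) m K' (RatFn.functionFieldMap V.ι G) ∧ ∀ y, idealOrder K' y < m) :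
    ∀ (p : ℕ), p.Prime → ∀ (S : Scheme.{0}) [IsIntegral S] [IsNoetherian S],
      CharP S.functionField p → Scheme.IsRegular S → Scheme.IsExcellent S → topologicalKrullDim S = 3 →
      ∀ G₀ : S.functionField, (∀ s : S, CleanRegAt p (algebraMap (S.presheaf.stalk s) S.functionField) G₀) →
      ∀ I : S.IdealSheafData, I ≠ ⊥ →
      ∀ (X : Scheme.{0}) (ρ : X ⟶ S) [IsIntegral X] [IsNoetherian X] [IsDominant ρ],
        IsCleanRegularCentreBlowupSeq p ρ I G₀ →
        (∀ x : X, CleanRegAt p (algebraMap (X.presheaf.stalk x) X.functionField) (RatFn.functionFieldMap ρ G₀)) →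
        ∀ (J : X.IdealSheafData) (μ : ℕ), 1 ≤ μ →
          (∀ x ∈ J.support, 1 < Order.coheight x) → (∀ x, idealOrder J x ≤ μ) → (∃ x, idealOrder J x = μ) →
          ∃ (X' : Scheme.{0}) (π : X' ⟶ X) (_ : IsIntegral X') (_ : IsDominant π) (J' : X'.IdealSheafData),
            IsCleanPermissibleSeq p π J μ J' (RatFn.functionFieldMap ρ G₀) ∧ ∀ x, idealOrder J' x < μ := by
  refine cleanProp44_of_tauOneResidualVN2 hphaseTwo ?_ ?_
  · intro p hp X _ _ hchar hX hqe hX3 G hG J m hm hle hcodim V x hxV hcl hbad hord hdim hτ hGr hnv _ _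
    exact htauOneVN p hp hchar hX hqe hX3 G hG J hm hle hcodim V x hxV hcl hbad hord hdim hτ hGr
      (fun h => hnv (forall_near_two_le_point_of_forall_near_two_le hX3 J m V x hxV hcl h))
  · intro p hp X _ _ hchar hX hqe hX3 G hG J m hm hle hcodim V Y hYreg hirr hYV hJY hordY hcurve hτ hnv _ _
    exact hcurveTauOneVN p hp hchar hX hqe hX3 G hG J hm hle hcodim V Y hYreg hirr hYV hJY hordY hcurve hτ
      (fun h => hnv ⟨h.1, forall_near_two_le_preimage_of_forall_near_two_le hX3 J m V Y h.2⟩)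

end Summit.ResolutionOfSingularities.ResolutionOfSingularities.Theorems.RadicialJung.CleanModels

end
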